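import Summits.Parity.GeneralizedHardyLittlewood.Theorems.PrimeLevelFamEdgeMomentsBeyondDiagonalDiagGenericRemKernels
import Summits.Parity.GeneralizedHardyLittlewood.Theorems.PrimeLevelFamEdgeMomentsBeyondDiagonalDiagGenericRemFamilies
import Summits.Parity.GeneralizedHardyLittlewood.Theorems.PrimeLevelFamEdgeMomentsBeyondDiagonalDiagGenericRemWeight
import Summits.Parity.GeneralizedHardyLittlewood.Theorems.PrimeLevelFamEdgeMomentsBeyondDiagonalDiagRemMonomials
import HarnessLib

/-!
# Route `PrimeLevelFamEdge`, crux K_A `MomentsBeyondDiagonal` (stmt-Parity-20007), line «petersson_layers» v4, stub `stub_diag`: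
# **the inner `(k₁,k₂)` estimate of the GENERIC remainder (R_ij) — abstract kernel coordinates, then Selberg coordinates**
# (bricks (R3)+(R6) of the census `Cruxes/MomentsBeyondDiagonal/Lines/petersson_layers_stub_diag_g19_generic_assembly.md`)

Generic version of `…DiagRemFourFourInnerAbstract` / `…InnerHolds` / `…InnerSelberg`: the order-`(i,j)` remainder weight (the `rem_ij` of
`…DiagGenericAssembly.selbergOrder_split i j`) against the profile `P(ℓ⁺(k₁)/L)P(ℓ⁺(k₂)/L)` and the coprime Selberg coefficients
`W_n(k) = [(k,n)=1]W(k)` (τ-free form: the decorations are the divisor moments `S_t(k) = Σ_{de=k}(log d − log e)^t` themselves,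
`S₀ = τ`). Inputs, all generic and landed: `…DiagGenericRemFamilies.families_gen` (one envelope for all `S_t ⊗ S_{t′}·R_ab`),
`…DiagGenericRemWeight.fam_weight_gen` (the five-level weight), `…DiagRemMonomials.profile_expand` (the profile), and for the Selberg
coordinates `…DiagGenericRemKernels.twoSeq_kernels_gen` (the explicit kernels `r_ab` with level-free `E_ab`, `μ_m`).

* `abs_profile_fam` — a family bound `log^{m₁+m₂}Y·Ψ` for every monomial `ℓ⁺^{m₁}ℓ⁺^{m₂}` (`m₁, m₂ ≥ 1`) gives `(Σ|P_m|)²·Ψ` for the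
  profile `P(ℓ⁺₁/L)P(ℓ⁺₂/L)` (`P(0) = 0`, `log Y ≤ L`) — `…DiagRemMonomials.abs_profile_weight_le` for an arbitrary weight;
* `abs_inner_rem_abstract_gen i j A` — **∃ `K ≥ 0`: for every kernel family `R_ab` (`a ≤ i`, `b ≤ j`) with two-sequence data
  `(C₀, i+j+2)` and pointwise data `(C₀, i+j+1)`, every `P` with `P(0)=0`, `n ≥ 1`, `Y ≥ 1`, `α > 0`, `2αK₁Y ≤ 1`, `|β|, log Y ≤ Λ`,
  `log Y ≤ L`: `|Σ_{k₁,k₂≤Y} W_n(k₁)P(ℓ⁺₁/L)W_n(k₂)P(ℓ⁺₂/L)·rem_ij(k₁,k₂)| ≤ (Σ|P_m|)²·K·C₀·D(n)²·Λ^{2(i+j)+2}·(√(2αK₁Y) + x^{i+j+2}/(1+log K₁)^A)`**;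
* `abs_inner_rem_selberg_gen i j A` — **the same in Selberg coordinates** (`Y = M/n`, `α = g²/Q²`, `β = log Q − log g − log Y`,
  `L = log M`, `Λ = 1 + 2log M + log Q`, `x ≤ 2Λ`; the weight written exactly as in (R_ij) at level `Q`, with the explicit kernels of
  `twoSeq_kernels_gen`): `≤ C·D(n)²·(Λ^{3(i+j)+4}√(2(g²/Q²)K₁(M/n)) + Λ^{3(i+j)+4}/(1+log K₁)^A)` — the input of
  `…DiagRemOuterPow.per_term_bound_gen_pow A`.

Def-free; theorems only. Helper `--supports stmt-Parity-20007`; closes nothing (the outer `(c,g)` sum = (R_ij) proper and `stub_diag` are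
filed next); K_A, K_B and the Parity summit are NOT proved; nothing about Landau–Siegel zeros.

## References
* E. Kowalski, P. Michel, J. VanderKam, J. reine angew. Math. 526 (2000), (23)–(28) pp. 13–15 and Prop. 5.1 p. 18.
  [cite: KowalskiMichelVanderKam2000, (23)–(28) and Prop. 5.1 — derivation (remainder of the diagonal, inner sums, every order)]
-/

noncomputable section

open Finset Real Polynomial MeasureTheory

namespace Summit.Parity.GeneralizedHardyLittlewood.Theorems.MomentsBeyondDiagonal.DiagCorner

open Literature.NumberTheory.LFunctions.KMV2000.MollifierMainTerm (W)
open Summit.Parity.GeneralizedHardyLittlewood.Theorems.BeyondDiagonalBeatsQuarter.KernelFormXSq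
  (divWeight divWeight_nonneg one_le_divWeight)
open Summit.Parity.GeneralizedHardyLittlewood.Theorems.BeyondDiagonalBeatsQuarter.Corner

/-! ### The profile against an arbitrary weight -/

set_option maxHeartbeats 1600000 in
/-- **A family bound for every monomial gives `(Σ|P_m|)²·Ψ` for the profile** (`P(0) = 0`, `0 < L`, `log Y ≤ L`).
[cite: KowalskiMichelVanderKam2000, Prop. 5.1 — derivation (profile expansion of the remainder)] -/
theorem abs_profile_fam (P : ℝ[X]) (hP0 : P.coeff 0 = 0) {a : ℕ → ℝ} {G : ℕ → ℕ → ℝ} {Y Ψ L : ℝ} (hY : 1 ≤ Y)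
    (hΨ : 0 ≤ Ψ) (hL : 0 < L) (hYL : Real.log Y ≤ L)
    (h : ∀ m₁ m₂ : ℕ, 1 ≤ m₁ → 1 ≤ m₂ →
      |∑ k₁ ∈ Icc 1 ⌊Y⌋₊, ∑ k₂ ∈ Icc 1 ⌊Y⌋₊,
          a k₁ * a k₂ * ellp Y k₁ ^ m₁ * ellp Y k₂ ^ m₂ * (G k₁ k₂)| ≤
        Real.log Y ^ (m₁ + m₂) * (Ψ)) :
    |∑ k₁ ∈ Icc 1 ⌊Y⌋₊, ∑ k₂ ∈ Icc 1 ⌊Y⌋₊,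
        a k₁ * P.eval (ellp Y k₁ / L) * (a k₂ * P.eval (ellp Y k₂ / L)) * G k₁ k₂| ≤
      (∑ i ∈ Finset.range (P.natDegree + 1), |P.coeff i|) ^ 2 * Ψ := by
  have hL0 : 0 ≤ Real.log Y := Real.log_nonneg hY
  set Rg := Finset.range (P.natDegree + 1) with hRg
  set SP : ℝ := ∑ i ∈ Rg, |P.coeff i| with hSP
  have hratio : Real.log Y / L ≤ 1 := (div_le_one hL).2 hYL
  have hratio0 : 0 ≤ Real.log Y / L := div_nonneg hL0 hL.le
  rw [profile_expand P L Y a a G (Icc 1 ⌊Y⌋₊)]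
  have hterm : ∀ i ∈ Rg, ∀ j ∈ Rg, |P.coeff i / L ^ i * (P.coeff j / L ^ j) *
      ∑ k₁ ∈ Icc 1 ⌊Y⌋₊, ∑ k₂ ∈ Icc 1 ⌊Y⌋₊, a k₁ * a k₂ * ellp Y k₁ ^ i * ellp Y k₂ ^ j * G k₁ k₂| ≤
      |P.coeff i| * |P.coeff j| * Ψ := by
    intro i _ j _
    rcases Nat.eq_zero_or_pos i with rfl | hi
    · rw [hP0]; simp
    rcases Nat.eq_zero_or_pos j with rfl | hj
    · rw [hP0]; simp
    rw [abs_mul, abs_mul, abs_div, abs_div, abs_of_pos (pow_pos hL i), abs_of_pos (pow_pos hL j)]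
    have h1 := h i j hi hj
    have hpow : Real.log Y ^ (i + j) / (L ^ i * L ^ j) ≤ 1 := by
      rw [← pow_add, ← div_pow]
      exact pow_le_one₀ hratio0 hratio
    calc |P.coeff i| / L ^ i * (|P.coeff j| / L ^ j) *
          |∑ k₁ ∈ Icc 1 ⌊Y⌋₊, ∑ k₂ ∈ Icc 1 ⌊Y⌋₊, a k₁ * a k₂ * ellp Y k₁ ^ i * ellp Y k₂ ^ j * G k₁ k₂|
        ≤ |P.coeff i| / L ^ i * (|P.coeff j| / L ^ j) * (Real.log Y ^ (i + j) * Ψ) :=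
          mul_le_mul_of_nonneg_left h1 (by positivity)
      _ = |P.coeff i| * |P.coeff j| * Ψ * (Real.log Y ^ (i + j) / (L ^ i * L ^ j)) := by
          field_simp
      _ ≤ |P.coeff i| * |P.coeff j| * Ψ * 1 := by gcongr
      _ = _ := mul_one _
  calc _ ≤ ∑ i ∈ Rg, ∑ j ∈ Rg, |P.coeff i| * |P.coeff j| * Ψ := by
        refine (Finset.abs_sum_le_sum_abs _ _).trans (Finset.sum_le_sum fun i hi ↦ ?_)
        exact (Finset.abs_sum_le_sum_abs _ _).trans (Finset.sum_le_sum fun j hj ↦ hterm i hi j hj)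
    _ = SP * SP * Ψ := by
        rw [hSP, Finset.sum_mul_sum, Finset.sum_mul]
        refine Finset.sum_congr rfl fun i _ ↦ ?_
        rw [Finset.sum_mul]
    _ = SP ^ 2 * Ψ := by ring

/-! ### The inner estimate in abstract kernel coordinates -/

set_option maxHeartbeats 6400000 in
/-- **The inner `(k₁,k₂)` estimate of the generic remainder (R_ij) in abstract kernel coordinates** (module docstring).
[cite: KowalskiMichelVanderKam2000, (23)–(28) and Prop. 5.1 — derivation (remainder of the diagonal, inner sums, every order)] -/
theorem abs_inner_rem_abstract_gen (i j A : ℕ) : ∃ K : ℝ, 0 ≤ K ∧ ∀ (C₀ : ℝ), 0 ≤ C₀ → ∀ (R : ℕ → ℕ → ℝ → ℝ),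
    (∀ a' b' : ℕ, a' ≤ i → b' ≤ j →
      (∀ (a₁ a₂ : ℕ → ℝ) (Y α B η : ℝ) (K₁ m₁ m₂ : ℕ), 1 ≤ Y → 0 < α → 1 ≤ m₁ → 1 ≤ m₂ →
      (∀ e : ℕ, e ≤ ⌊Y⌋₊ → |∑ k ∈ Icc 1 e, a₂ k| ≤ B) → (∀ e : ℕ, K₁ ≤ e → |∑ k ∈ Icc 1 e, a₁ k| ≤ η) →
      2 * α * K₁ * Y ≤ 1 →
    |∑ k₁ ∈ Icc 1 ⌊Y⌋₊, ∑ k₂ ∈ Icc 1 ⌊Y⌋₊,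
        a₁ k₁ * a₂ k₂ * ellp Y k₁ ^ m₁ * ellp Y k₂ ^ m₂ * R a' b' (α * k₁ * k₂)| ≤
      (∑ k ∈ Icc 1 ⌊Y⌋₊, |a₁ k| * ellp Y k ^ m₁) * (B * (Real.log Y ^ m₂ * (3 * C₀ * Real.sqrt (2 * α * K₁ * Y)))) +
        (∑ k ∈ Icc 1 ⌊Y⌋₊, |a₂ k| * ellp Y k ^ m₂) *
          ((2 * η) * (Real.log Y ^ m₁ * (9 * C₀ * (1 + |Real.log (2 * α * Y ^ 2)|) ^ (i + j + 2))))) ∧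
      (∀ y : ℝ, 0 < y → y ≤ 1 → |R a' b' y| ≤ C₀ * Real.sqrt y) ∧
      (∀ y : ℝ, 1 ≤ y → |R a' b' y| ≤ C₀ * (1 + Real.log y) ^ (i + j + 1))) →
    ∀ (P : ℝ[X]), P.coeff 0 = 0 → ∀ n : ℕ, n ≠ 0 → ∀ (Y α β Λ L : ℝ) (K₁ : ℕ), 1 ≤ Y → 0 < α →
      2 * α * K₁ * Y ≤ 1 → 1 ≤ Λ → |β| ≤ Λ → Real.log Y ≤ Λ → 0 < L → Real.log Y ≤ L →
    |∑ k₁ ∈ Icc 1 ⌊Y⌋₊, ∑ k₂ ∈ Icc 1 ⌊Y⌋₊,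
        (if k₁.Coprime n then W k₁ else 0) * P.eval (ellp Y k₁ / L) * ((if k₂.Coprime n then W k₂ else 0) * P.eval (ellp Y k₂ / L)) *
          (∑ a ∈ range (i + 1), ∑ b ∈ range (j + 1),
                (i.choose a : ℝ) * (j.choose b) *
                ((1 / 2) ^ (i - a + (j - b)) * ∑ r ∈ range (i - a + 1), ∑ s ∈ range (j - b + 1),
                  ((i - a).choose r : ℝ) * ((j - b).choose s) * (-1) ^ s *
                      (2 * β + ellp Y k₁ + ellp Y k₂) ^ (i - a - r + (j - b - s)) *
                    ∑ t ∈ range (r + s + 1), ((r + s).choose t : ℝ) *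
                      ((∑ x ∈ k₁.divisorsAntidiagonal, (Real.log x.1 - Real.log x.2) ^ t) *
                        (∑ x ∈ k₂.divisorsAntidiagonal, (Real.log x.1 - Real.log x.2) ^ (r + s - t)))) *
                R a b (α * k₁ * k₂))| ≤
      (∑ i ∈ Finset.range (P.natDegree + 1), |P.coeff i|) ^ 2 *
        (K * C₀ * divWeight n ^ 2 * Λ ^ (2 * (i + j) + 2) *
          (Real.sqrt (2 * α * K₁ * Y) + (1 + |Real.log (2 * α * Y ^ 2)|) ^ (i + j + 2) / (1 + Real.log K₁) ^ A)) := by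
  obtain ⟨Kf, hKf0, hKf⟩ := families_gen (i + j) A
  obtain ⟨Kw, hKw0, hKw⟩ := fam_weight_gen i j
  refine ⟨Kw * Kf * (4 ^ (i + j) * 2 ^ (i + j + 2)), by positivity,
    fun C₀ hC₀ R hker P hP0 n hn Y α β Λ L K₁ hY hα hY₁ hΛ hβ hLY hL hYL ↦ ?_⟩
  have hLY0 : 0 ≤ Real.log Y := Real.log_nonneg hY
  set D : ℝ := divWeight n with hD
  have hK10 : 0 ≤ Real.log (K₁ : ℝ) := Real.log_natCast_nonneg K₁
  set T : ℝ := Real.sqrt (2 * α * K₁ * Y) + (1 + |Real.log (2 * α * Y ^ 2)|) ^ (i + j + 2) / (1 + Real.log K₁) ^ A with hT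
  have hT0 : 0 ≤ T := by positivity
  set Ψ : ℝ := C₀ * (Kf * D ^ 2 * (1 + Real.log Y) ^ (i + j + 2)) * T with hΨ
  have hΨ0 : 0 ≤ Ψ := by positivity
  -- the families
  have hfam : ∀ a' b' t t' : ℕ, a' ≤ i → b' ≤ j → t ≤ i + j → t' ≤ i + j → ∀ m₁ m₂ : ℕ, 1 ≤ m₁ → 1 ≤ m₂ →
      |∑ k₁ ∈ Icc 1 ⌊Y⌋₊, ∑ k₂ ∈ Icc 1 ⌊Y⌋₊,
          (if k₁.Coprime n then W k₁ else 0) * (if k₂.Coprime n then W k₂ else 0) * ellp Y k₁ ^ m₁ * ellp Y k₂ ^ m₂ *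
            ((∑ x ∈ k₁.divisorsAntidiagonal, (Real.log x.1 - Real.log x.2) ^ t) * (∑ x ∈ k₂.divisorsAntidiagonal, (Real.log x.1 - Real.log x.2) ^ t') * R a' b' (α * k₁ * k₂))| ≤
        Real.log Y ^ (m₁ + m₂) * Ψ := by
    intro a' b' t t' ha hb ht ht' m₁ m₂ hm₁ hm₂
    obtain ⟨h2, hs, ht2⟩ := hker a' b' ha hb
    exact hKf (i + j + 2) (i + j + 1) (by omega) C₀ hC₀ (R a' b') h2 hs ht2 t t' ht ht' n hn Y α K₁ m₁ m₂ hY hα hm₁ hm₂ hY₁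
  -- the weight
  have hw := hKw (fun k ↦ if k.Coprime n then W k else 0)
    (fun t k ↦ ∑ x ∈ k.divisorsAntidiagonal, (Real.log x.1 - Real.log x.2) ^ t) R Y α β Λ Ψ hΛ hβ hLY0 hLY hΨ0 hfam
  beta_reduce at hw
  -- the profile
  have hprof := abs_profile_fam P hP0 hY (by positivity : 0 ≤ Kw * (4 * Λ) ^ (i + j) * Ψ) hL hYL hw
  refine hprof.trans (mul_le_mul_of_nonneg_left ?_ (sq_nonneg _))
  -- envelope arithmetic
  have hΛ0 : 0 ≤ Λ := zero_le_one.trans hΛ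
  have h1Y : 1 + Real.log Y ≤ 2 * Λ := by linarith
  have h1Y0 : 0 ≤ 1 + Real.log Y := by linarith
  calc Kw * (4 * Λ) ^ (i + j) * Ψ
      = Kw * Kf * 4 ^ (i + j) * C₀ * D ^ 2 * T * (Λ ^ (i + j) * (1 + Real.log Y) ^ (i + j + 2)) := by
        rw [hΨ, mul_pow]; ring
    _ ≤ Kw * Kf * 4 ^ (i + j) * C₀ * D ^ 2 * T * (Λ ^ (i + j) * (2 * Λ) ^ (i + j + 2)) := by
        gcongr
    _ = Kw * Kf * (4 ^ (i + j) * 2 ^ (i + j + 2)) * C₀ * D ^ 2 * Λ ^ (2 * (i + j) + 2) * T := by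
        rw [mul_pow, show 2 * (i + j) + 2 = (i + j) + (i + j + 2) by ring, pow_add]; ring

/-! ### The inner estimate in Selberg coordinates -/

set_option maxHeartbeats 6400000 in
/-- **The inner `(k₁,k₂)` estimate of the generic remainder (R_ij) in Selberg coordinates** (module docstring): level `Q`, mollifier
length `M`, `n = cg`, threshold `K₁` with `2(g²/Q²)K₁(M/n) ≤ 1`; the weight is the `(c,g)`-summand weight of (R_ij) verbatim.
[cite: KowalskiMichelVanderKam2000, (23)–(28) and Prop. 5.1 — derivation (remainder of the diagonal, inner sums, Selberg coordinates)] -/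
theorem abs_inner_rem_selberg_gen (i j A : ℕ) : ∀ P : ℝ[X], P.coeff 0 = 0 → ∃ C : ℝ, 0 < C ∧
    ∀ (n g : ℕ), n ≠ 0 → g ≠ 0 → ∀ (Q M : ℝ), 2 ≤ Q → 2 ≤ M → (n : ℝ) ≤ M → (g : ℝ) ≤ M → ∀ K₁ : ℕ,
      2 * ((g : ℝ) ^ 2 / Q ^ 2) * K₁ * (M / n) ≤ 1 →
    |∑ k₁ ∈ Icc 1 ⌊M / (n : ℝ)⌋₊, ∑ k₂ ∈ Icc 1 ⌊M / (n : ℝ)⌋₊,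
        (if k₁.Coprime n then W k₁ else 0) * P.eval (ellp (M / (n : ℝ)) k₁ / Real.log M) *
          ((if k₂.Coprime n then W k₂ else 0) * P.eval (ellp (M / (n : ℝ)) k₂ / Real.log M)) *
          (∑ a ∈ range (i + 1), ∑ b ∈ range (j + 1),
                (i.choose a : ℝ) * (j.choose b) *
                ((1 / 2) ^ (i - a + (j - b)) * ∑ r ∈ range (i - a + 1), ∑ s ∈ range (j - b + 1),
                  ((i - a).choose r : ℝ) * ((j - b).choose s) * (-1) ^ s *
                      (2 * (Real.log Q - Real.log g) - Real.log k₁ - Real.log k₂) ^ (i - a - r + (j - b - s)) *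
                    ∑ t ∈ range (r + s + 1), ((r + s).choose t : ℝ) *
                      ((∑ d ∈ k₁.divisors, (2 * Real.log d - Real.log k₁) ^ t) *
                        (∑ e ∈ k₂.divisors, (2 * Real.log e - Real.log k₂) ^ (r + s - t)))) *
                ((∫ u₁ in Set.Ioi (0 : ℝ), Real.log u₁ ^ a * ∫ u₂ in Set.Ioi ((((g * g * (k₁ * k₂) : ℕ) : ℝ) / Q ^ 2) / u₁), Real.exp (-(u₁ + u₂)) / (1 - Real.exp (-(u₁ + u₂))) ^ 2 * Real.log u₂ ^ b) - (((∫ u₁ in Set.Ioi (0 : ℝ), Real.log u₁ ^ a * ∫ u₂ in Set.Ioi (1 / u₁), Real.exp (-(u₁ + u₂)) / (1 - Real.exp (-(u₁ + u₂))) ^ 2 * Real.log u₂ ^ b) + (∫ η in Set.Ioc (0 : ℝ) 1, (η * (∫ u in Set.Ioi (0 : ℝ), Real.log u ^ a * Real.log (η / u) ^ b * (Real.exp (-(u + η / u)) / (1 - Real.exp (-(u + η / u))) ^ 2) / u) - ∫ v in Set.Ioc (0 : ℝ) 1, ((-(Real.log (1 / η) / 2) + Real.log v) ^ a * (-(Real.log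 (1 / η) / 2) - Real.log v) ^ b + (-(Real.log (1 / η) / 2) - Real.log v) ^ a * (-(Real.log (1 / η) / 2) + Real.log v) ^ b) * (v / (1 + v ^ 2) ^ 2)) / η)) + ∑ i' ∈ Finset.range (a + 1), ∑ j' ∈ Finset.range (b + 1), ((a).choose i' : ℝ) * ((b).choose j' : ℝ) * ((-1) ^ j' + (-1) ^ i') * (∫ v in Set.Ioc (0 : ℝ) 1, Real.log v ^ (i' + j') * (v / (1 + v ^ 2) ^ 2)) * ((-1 / 2 : ℝ) ^ (a - i' + (b - j')) * (2 * (Real.log Q - Real.log g) - Real.log k₁ - Real.log k₂) ^ (a - i' + (b - j') + 1) / (((a - i' + (b - j') : ℕ) : ℝ) + 1)))))| ≤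
      C * divWeight n ^ 2 *
        ((1 + 2 * Real.log M + Real.log Q) ^ (3 * (i + j) + 4) * Real.sqrt (2 * ((g : ℝ) ^ 2 / Q ^ 2) * K₁ * (M / n)) +
          (1 + 2 * Real.log M + Real.log Q) ^ (3 * (i + j) + 4) / (1 + Real.log K₁) ^ A) := by
  intro P hP0
  obtain ⟨C₀, hC₀, hker⟩ := twoSeq_kernels_gen i j
  obtain ⟨K, hK, hI⟩ := abs_inner_rem_abstract_gen i j A
  have hIK := hI C₀ hC₀ (fun a b y ↦ ((∫ u₁ in Set.Ioi (0 : ℝ), Real.log u₁ ^ a * ∫ u₂ in Set.Ioi (y / u₁), Real.exp (-(u₁ + u₂)) / (1 - Real.exp (-(u₁ + u₂))) ^ 2 * Real.log u₂ ^ b) - (((∫ u₁ in Set.Ioi (0 : ℝ), Real.log u₁ ^ a * ∫ u₂ in Set.Ioi (1 / u₁), Real.exp (-(u₁ + u₂)) / (1 - Real.exp (-(u₁ + u₂))) ^ 2 * Real.log u₂ ^ b) + (∫ η in Set.Ioc (0 : ℝ) 1, (η * (∫ u in Set.Ioi (0 : ℝ), Real.log u ^ a * Real.log (η / u) ^ b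 * (Real.exp (-(u + η / u)) / (1 - Real.exp (-(u + η / u))) ^ 2) / u) - ∫ v in Set.Ioc (0 : ℝ) 1, ((-(Real.log (1 / η) / 2) + Real.log v) ^ a * (-(Real.log (1 / η) / 2) - Real.log v) ^ b + (-(Real.log (1 / η) / 2) - Real.log v) ^ a * (-(Real.log (1 / η) / 2) + Real.log v) ^ b) * (v / (1 + v ^ 2) ^ 2)) / η)) + ∑ i' ∈ Finset.range (a + 1), ∑ j' ∈ Finset.range (b + 1), ((a).choose i' : ℝ) * ((b).choose j' : ℝ) * ((-1) ^ j' + (-1) ^ i') * (∫ v in Set.Ioc (0 : ℝ) 1, Real.log v ^ (i' + j') * (v / (1 + v ^ 2) ^ 2)) * ((-1 / 2 : ℝ) ^ (a - i' + (b - j')) * Real.log (1 / y) ^ (a - i' + (b - j') + 1) / (((a - i' + (b - j') : ℕ) : ℝ) + 1))))) hker P hP0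
  set SP : ℝ := ∑ i ∈ Finset.range (P.natDegree + 1), |P.coeff i| with hSP
  have hSP0 : 0 ≤ SP := Finset.sum_nonneg fun i _ ↦ abs_nonneg _
  refine ⟨SP ^ 2 * (K * C₀) * 2 ^ (i + j + 2) + 1, by positivity, fun n g hn hg Q M hQ2 hM2 hnM hgM K₁ hK₁ ↦ ?_⟩
  have hn0 : (0 : ℝ) < n := by exact_mod_cast Nat.pos_of_ne_zero hn
  have hg0 : (0 : ℝ) < g := by exact_mod_cast Nat.pos_of_ne_zero hg
  have hg1 : (1 : ℝ) ≤ g := by exact_mod_cast Nat.one_le_iff_ne_zero.2 hg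
  have hQ0 : 0 < Q := by linarith
  have hM0 : 0 < M := by linarith
  set Y : ℝ := M / n with hYdef
  set L : ℝ := Real.log M with hLdef
  set α : ℝ := (g : ℝ) ^ 2 / Q ^ 2 with hαdef
  have hα : 0 < α := by positivity
  have hY : 1 ≤ Y := by rw [hYdef, le_div_iff₀ hn0]; linarith
  have hY0 : 0 < Y := by linarith only [hY]
  have hYM : Y ≤ M := div_le_self hM0.le (by exact_mod_cast Nat.one_le_iff_ne_zero.2 hn)
  have hL0 : 0 < L := Real.log_pos (by linarith)
  have hLY0 : 0 ≤ Real.log Y := Real.log_nonneg hY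
  have hLYL : Real.log Y ≤ L := Real.log_le_log hY0 hYM
  obtain ⟨hlogQ, hlogg0, hloggM⟩ : 0 ≤ Real.log Q ∧ 0 ≤ Real.log g ∧ Real.log g ≤ L :=
    ⟨Real.log_nonneg (by linarith), Real.log_nonneg hg1, Real.log_le_log hg0 hgM⟩
  set Lam : ℝ := 1 + 2 * Real.log M + Real.log Q with hLamdef
  have hLam1 : 1 ≤ Lam := by rw [hLamdef]; linarith
  have hLam0 : 0 < Lam := by linarith
  set β : ℝ := Real.log Q - Real.log g - Real.log Y with hβdef
  have hβ : |β| ≤ Lam := by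
    rw [hβdef, hLamdef, abs_le]; constructor <;> linarith
  have hLYLam : Real.log Y ≤ Lam := by rw [hLamdef]; linarith
  have hD0 : 0 ≤ divWeight n := divWeight_nonneg n
  have hxLam : 1 + |Real.log (2 * α * Y ^ 2)| ≤ 2 * Lam := by
    have hl2 : Real.log 2 < 1 := by have := Real.log_two_lt_d9; linarith
    have hl2' : 0 < Real.log 2 := Real.log_pos (by norm_num)
    have hlog : Real.log (2 * α * Y ^ 2) = Real.log 2 + (2 * Real.log g - 2 * Real.log Q) + 2 * Real.log Y := by
      rw [hαdef, Real.log_mul (by positivity) (by positivity), Real.log_mul (by norm_num) (by positivity),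
        Real.log_pow, Real.log_div (by positivity) (by positivity), Real.log_pow, Real.log_pow]
      push_cast; ring
    rw [hlog, hLamdef]
    have := abs_le.2 (⟨by linarith, by linarith⟩ :
      -(1 + 4 * Real.log M + 2 * Real.log Q) ≤ Real.log 2 + (2 * Real.log g - 2 * Real.log Q) + 2 * Real.log Y ∧
        Real.log 2 + (2 * Real.log g - 2 * Real.log Q) + 2 * Real.log Y ≤ 1 + 4 * Real.log M + 2 * Real.log Q)
    linarith
  have hx0 : 0 ≤ 1 + |Real.log (2 * α * Y ^ 2)| := by positivity
  have hK0 : 0 ≤ Real.log (K₁ : ℝ) := Real.log_natCast_nonneg K₁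
  have key := hIK n hn Y α β Lam L K₁ hY hα hK₁ hLam1 hβ hLYLam hL0 hLYL
  beta_reduce at key
  -- the coordinate identities under the sum
  have hLk : ∀ k₁ ∈ Icc 1 ⌊Y⌋₊, ∀ k₂ ∈ Icc 1 ⌊Y⌋₊,
      2 * (Real.log Q - Real.log g) - Real.log k₁ - Real.log k₂ = 2 * β + ellp Y k₁ + ellp Y k₂ := by
    intro k₁ hk₁ k₂ hk₂
    have h1 : (0 : ℝ) < k₁ := by exact_mod_cast (Finset.mem_Icc.1 hk₁).1
    have h2 : (0 : ℝ) < k₂ := by exact_mod_cast (Finset.mem_Icc.1 hk₂).1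
    rw [ellp_eq_log hY0.le hk₁, ellp_eq_log hY0.le hk₂, Real.log_div hY0.ne' h1.ne', Real.log_div hY0.ne' h2.ne',
      hβdef]
    ring
  have hy : ∀ k₁ k₂ : ℕ, ((g * g * (k₁ * k₂) : ℕ) : ℝ) / Q ^ 2 = α * k₁ * k₂ := by
    intro k₁ k₂; rw [hαdef]; push_cast; ring
  have hlg : ∀ k₁ ∈ Icc 1 ⌊Y⌋₊, ∀ k₂ ∈ Icc 1 ⌊Y⌋₊,
      2 * (Real.log Q - Real.log g) - Real.log k₁ - Real.log k₂ = Real.log (1 / (α * k₁ * k₂)) := by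
    intro k₁ hk₁ k₂ hk₂
    have h1 : (0 : ℝ) < k₁ := by exact_mod_cast (Finset.mem_Icc.1 hk₁).1
    have h2 : (0 : ℝ) < k₂ := by exact_mod_cast (Finset.mem_Icc.1 hk₂).1
    rw [hαdef, one_div, Real.log_inv, Real.log_mul (by positivity) h2.ne', Real.log_mul (by positivity) h1.ne',
      Real.log_div (by positivity) (by positivity), Real.log_pow, Real.log_pow]
    push_cast; ring
  have hS : ∀ (t k : ℕ), ∑ d ∈ k.divisors, (2 * Real.log d - Real.log k) ^ t =
      ∑ x ∈ k.divisorsAntidiagonal, (Real.log x.1 - Real.log x.2) ^ t := by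
    intro t k
    rw [Nat.sum_divisorsAntidiagonal fun a b ↦ (Real.log a - Real.log b) ^ t]
    refine Finset.sum_congr rfl fun d hd ↦ ?_
    have hdk : d ∣ k := Nat.dvd_of_mem_divisors hd
    have hk0 : k ≠ 0 := (Nat.mem_divisors.1 hd).2
    have hd0 : d ≠ 0 := ne_zero_of_dvd_ne_zero hk0 hdk
    rw [Nat.cast_div hdk (by exact_mod_cast hd0), Real.log_div (by exact_mod_cast hk0) (by exact_mod_cast hd0)]
    ring
  refine le_trans (le_of_eq ?_) (key.trans ?_)
  · refine congrArg abs (Finset.sum_congr rfl fun k₁ hk₁ ↦ Finset.sum_congr rfl fun k₂ hk₂ ↦ ?_)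
    simp only [hS]
    rw [← hLk k₁ hk₁ k₂ hk₂, ← hlg k₁ hk₁ k₂ hk₂, ← hy k₁ k₂]
  -- the envelope: `Λ^{2s+2}(sq + x^{s+2}/K) ≤ (2^{s+2}·…+1)·(Λ^{3s+4} sq + Λ^{3s+4}/K)`
  have hs0 : 0 ≤ Real.sqrt (2 * α * K₁ * Y) := Real.sqrt_nonneg _
  have hKA : 0 < (1 + Real.log (K₁ : ℝ)) ^ A := by positivity
  have hxN : (1 + |Real.log (2 * α * Y ^ 2)|) ^ (i + j + 2) ≤ 2 ^ (i + j + 2) * Lam ^ (i + j + 2) := by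
    rw [← mul_pow]; exact pow_le_pow_left₀ hx0 hxLam _
  have hpow : Lam ^ (2 * (i + j) + 2) * Lam ^ (i + j + 2) = Lam ^ (3 * (i + j) + 4) := by
    rw [← pow_add]; congr 1; ring
  have hLamle : Lam ^ (2 * (i + j) + 2) ≤ Lam ^ (3 * (i + j) + 4) := pow_le_pow_right₀ hLam1 (by omega)
  have hL2 : 0 ≤ Lam ^ (2 * (i + j) + 2) := by positivity
  have hSK : 0 ≤ SP ^ 2 * (K * C₀) := by positivity
  have hD2 : 0 ≤ divWeight n ^ 2 := by positivity
  have h2p : (1 : ℝ) ≤ 2 ^ (i + j + 2) := one_le_pow₀ (by norm_num)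
  have hfin : SP ^ 2 * (K * C₀ * divWeight n ^ 2 * Lam ^ (2 * (i + j) + 2) *
      (Real.sqrt (2 * α * K₁ * Y) + (1 + |Real.log (2 * α * Y ^ 2)|) ^ (i + j + 2) / (1 + Real.log K₁) ^ A)) ≤
      (SP ^ 2 * (K * C₀) * 2 ^ (i + j + 2) + 1) * divWeight n ^ 2 *
        (Lam ^ (3 * (i + j) + 4) * Real.sqrt (2 * α * K₁ * Y) + Lam ^ (3 * (i + j) + 4) / (1 + Real.log K₁) ^ A) := by
    have h1 : Lam ^ (2 * (i + j) + 2) * Real.sqrt (2 * α * K₁ * Y) ≤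
        2 ^ (i + j + 2) * (Lam ^ (3 * (i + j) + 4) * Real.sqrt (2 * α * K₁ * Y)) := by
      have := mul_le_mul_of_nonneg_right hLamle hs0
      nlinarith [mul_nonneg (pow_nonneg hLam0.le (3 * (i + j) + 4)) hs0]
    have h2 : Lam ^ (2 * (i + j) + 2) * (1 + |Real.log (2 * α * Y ^ 2)|) ^ (i + j + 2) ≤
        2 ^ (i + j + 2) * Lam ^ (3 * (i + j) + 4) := by
      calc _ ≤ Lam ^ (2 * (i + j) + 2) * (2 ^ (i + j + 2) * Lam ^ (i + j + 2)) := mul_le_mul_of_nonneg_left hxN hL2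
        _ = 2 ^ (i + j + 2) * Lam ^ (3 * (i + j) + 4) := by rw [← hpow]; ring
    have h3 : Lam ^ (2 * (i + j) + 2) * (Real.sqrt (2 * α * K₁ * Y) +
        (1 + |Real.log (2 * α * Y ^ 2)|) ^ (i + j + 2) / (1 + Real.log K₁) ^ A) ≤
        2 ^ (i + j + 2) * (Lam ^ (3 * (i + j) + 4) * Real.sqrt (2 * α * K₁ * Y) +
          Lam ^ (3 * (i + j) + 4) / (1 + Real.log K₁) ^ A) := by
      have h2' : Lam ^ (2 * (i + j) + 2) * (1 + |Real.log (2 * α * Y ^ 2)|) ^ (i + j + 2) / (1 + Real.log K₁) ^ A ≤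
          2 ^ (i + j + 2) * Lam ^ (3 * (i + j) + 4) / (1 + Real.log K₁) ^ A := div_le_div_of_nonneg_right h2 hKA.le
      calc _ = Lam ^ (2 * (i + j) + 2) * Real.sqrt (2 * α * K₁ * Y) +
            Lam ^ (2 * (i + j) + 2) * (1 + |Real.log (2 * α * Y ^ 2)|) ^ (i + j + 2) / (1 + Real.log K₁) ^ A := by ring
        _ ≤ 2 ^ (i + j + 2) * (Lam ^ (3 * (i + j) + 4) * Real.sqrt (2 * α * K₁ * Y)) +
            2 ^ (i + j + 2) * Lam ^ (3 * (i + j) + 4) / (1 + Real.log K₁) ^ A := add_le_add h1 h2'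
        _ = _ := by ring
    have h4 : 0 ≤ Lam ^ (3 * (i + j) + 4) * Real.sqrt (2 * α * K₁ * Y) + Lam ^ (3 * (i + j) + 4) / (1 + Real.log K₁) ^ A := by
      positivity
    calc SP ^ 2 * (K * C₀ * divWeight n ^ 2 * Lam ^ (2 * (i + j) + 2) *
          (Real.sqrt (2 * α * K₁ * Y) + (1 + |Real.log (2 * α * Y ^ 2)|) ^ (i + j + 2) / (1 + Real.log K₁) ^ A))
        = SP ^ 2 * (K * C₀) * divWeight n ^ 2 * (Lam ^ (2 * (i + j) + 2) *
          (Real.sqrt (2 * α * K₁ * Y) + (1 + |Real.log (2 * α * Y ^ 2)|) ^ (i + j + 2) / (1 + Real.log K₁) ^ A)) := by ring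
      _ ≤ SP ^ 2 * (K * C₀) * divWeight n ^ 2 *
          (2 ^ (i + j + 2) * (Lam ^ (3 * (i + j) + 4) * Real.sqrt (2 * α * K₁ * Y) +
            Lam ^ (3 * (i + j) + 4) / (1 + Real.log K₁) ^ A)) :=
          mul_le_mul_of_nonneg_left h3 (mul_nonneg hSK hD2)
      _ = (SP ^ 2 * (K * C₀) * 2 ^ (i + j + 2)) * divWeight n ^ 2 *
          (Lam ^ (3 * (i + j) + 4) * Real.sqrt (2 * α * K₁ * Y) + Lam ^ (3 * (i + j) + 4) / (1 + Real.log K₁) ^ A) := by ring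
      _ ≤ (SP ^ 2 * (K * C₀) * 2 ^ (i + j + 2) + 1) * divWeight n ^ 2 *
          (Lam ^ (3 * (i + j) + 4) * Real.sqrt (2 * α * K₁ * Y) + Lam ^ (3 * (i + j) + 4) / (1 + Real.log K₁) ^ A) := by
          gcongr; linarith
  simpa only [hSP] using hfin

end Summit.Parity.GeneralizedHardyLittlewood.Theorems.MomentsBeyondDiagonal.DiagCorner

end
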